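import Literature.Topology.FourManifolds.SteinBisectionAchiralWordModel
import Literature.Topology.FourManifolds.MultiAttachmentEuler
import Literature.Topology.FourManifolds.OneHandlebodyBoundaryBetti
import Literature.Topology.FourManifolds.MorseHomologyVanishing
import Literature.Topology.FourManifolds.TwoHandleAttachmentPi1Four
import HarnessLib

/-!
# The Euler count of a Lefschetz handlebody (dictionary fact E): `|w| = b₁(P)` for a ℚ-acyclic
# `X(P; w)` over a page with connected boundary, from the first Betti number of a page system

Topic `Literature/Topology/FourManifolds`.  Gompf–Stipsicz, *4-Manifolds and Kirby Calculus*
(1999), §8.2 (with Kas 1980): the Lefschetz handlebody `X(P; w)` of a word `w` of vanishing cycles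
over a compact connected surface `P` with nonempty boundary is `P × D² ≅ ♮ᵏ S¹ × B³`, `k = b₁(P)`
(one `0`-handle and `b₁(P)` `1`-handles), with `|w|` two-handles attached, so
`χ(X(P; w)) = 1 - b₁(P) + |w|`; if `X(P; w)` is ℚ-acyclic in positive degrees then, being
connected, `χ = 1` and `|w| = b₁(P)`.  This file PROVES the dictionary fact
`length_eq_bettiNumber_of_isLefschetzHandlebodyOver` (`SteinBisectionAchiralWordModel.lean`: fact E of
the achiral word model of an acyclic Stein bisection) from ONE named printed fact, (E-d) below,
by assembling proved sub-lemmas of the tree — E = (E-a) + (E-b) + (E-c) + (E-d):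

* (E-a) `HandleAttachingMap.IsMultiAttachment.finRelHomology_relEuler`
  (`MultiAttachmentEuler.lean`, Gompf–Stipsicz §4.2 p. 111): `χ_ℚ(W) = χ_ℚ(B) + |w|` for the
  simultaneous Kosinski attachment `W` of `|w|` two-handles to the base `B`;
* (E-b) the Morse count of the base: `B` is a compact connected `4`-dimensional `1`-handlebody
  (`IsHandlebodyOfIndexLE 3 1 B`: a Morse function adapted to `∂B` with all indices `≤ 1`), so
  `H_j(B; ℚ) = 0` for `j ≥ 2` (`IsMorseAdapted.isZero_singularHomology_of_forall_morseIndex_ne`,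
  Milnor 1963 Thm. 3.5 / §5) and `H_•(B; ℚ)` is finitely generated
  (`IsMorseAdapted.finRelHomology_empty`, Matsumoto 2002 Cor. 4.19); with `B` connected,
  `χ_ℚ(B) = 1 - b₁(B; ℚ)`;
* (E-c) `finrank_singularHomology_one_boundaryData_eq` (`OneHandlebodyBoundaryBetti.lean`,
  Lefschetz duality over `ℚ` for the oriented `B` with `H₂ = H₃ = 0`): `b₁(∂B; ℚ) = b₁(B; ℚ)`;
* (E-d) the **named fact** `finrank_singularHomology_one_eq_bettiNumber_of_isPageSystem`: the
  closed `3`-manifold `∂B`, whose open book is trivialised by a page system `J : P × ℝ → ∂B`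
  (`IsPageSystem`: monodromy the identity) with CONNECTED page boundary, has `b₁(∂B; ℚ) = b₁(P)`
  (Etnyre–Fuller 2006, §2; Gompf–Stipsicz 1999, §8.2: `∂(P × D²) = #^{b₁(P)} S¹ × S²`
  homologically).

With `W` path connected (proved here from Kosinski's open cover of a multi-attachment,
`HandleAttachingMap.IsMultiAttachment.pathConnectedSpace₄`: the base minus the attaching circles
is path connected, `HandleAttachingMap.isPathConnected_compl_iUnion_core₄`, and every handle piece
`D⁴ ∖ S` is path connected, `contractibleSpace_beltPiece₄`, and meets it along `T ∖ S ≠ ∅`) and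
ℚ-acyclic in positive degrees, `χ_ℚ(W) = b₀(W; ℚ) = 1` (Hatcher 2002, Prop. 2.7), and the four
items give `1 = (1 - b₁(P)) + |w|` in `ℤ`.

Contents: the named fact (E-d) (a `def … : Prop`, cited; its proof — Mayer–Vietoris on
`∂B = (∂B ∖ binding) ∪ ν(binding)` with `∂B ∖ binding ≅ int P × S¹` — is the business of the
separate theorem `IsPageSystem.finrank_singularHomology_one_eq_bettiNumber`, NOT of this file), the
connectivity lemma, and the assembly
`length_eq_bettiNumber_of_isLefschetzHandlebodyOver_of_isPageSystemBetti : (E-d) → (E)`.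
No `sorry`, no axioms; nothing else is asserted.

## References

* R. E. Gompf, A. I. Stipsicz, *4-Manifolds and Kirby Calculus*, GSM 20 (1999), §8.2 (p. 292),
  §4.2 (p. 111). [GompfStipsiczGSM1999]
* J. B. Etnyre, T. Fuller, *Realizing 4-manifolds as achiral Lefschetz fibrations*, IMRN 2006,
  §2. [EtnyreFuller2006]
* A. Kas, *On the handlebody decomposition associated to a Lefschetz fibration*, Pacific J. Math.
  89 (1980), 89–104. [Kas1980]
* A. A. Kosinski, *Differential Manifolds* (1993), VI §6. [Kosinski1993]
* A. Hatcher, *Algebraic Topology* (2002), Prop. 2.7, §2.2 p. 146. [HatcherAT2002]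
-/

noncomputable section

open scoped Manifold ContDiff
open Set Function CategoryTheory CategoryTheory.Limits Literature.AlgebraicTopology.SingularHomology

namespace Literature.Topology.FourManifolds

universe u v

/-! ### (E-d) The first Betti number of an identity open book with connected page boundary -/

/-- **First Betti number of an open book with identity monodromy and connected page boundary**
(Etnyre–Fuller 2006, §2; Gompf–Stipsicz 1999, §8.2; Etnyre 2006, Lectures on open book
decompositions, §2): if the open book `ob` of the closed 3-manifold `M` is trivialised by a page
system `J : P × ℝ → M` (`IsPageSystem`: `M ∖ B ≅ int P × S¹` page-wise, monodromy the identity) and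
the page `P` — a compact connected surface — has CONNECTED boundary, then
`b₁(M; ℚ) = b₁(P)`: Mayer–Vietoris for `M = (M ∖ B) ∪ ν(B)`, `H₁(M ∖ B; ℚ) ≅ H₁(P; ℚ) ⊕ ℚ[fibre]`
(Künneth), the meridian of the (connected) binding maps to the fibre class (degree `1`,
`OpenBook.proj_tube`) and its longitude to `[∂P] = 0 ⊕ ±[B]`; so `M = #^{b₁(P)} S¹ × S²`
homologically.  FALSE without the connected-boundary hypothesis (Hopf open book of `S³`: annulus
page, `b₁(S³) = 0 ≠ 1`; tree `PlanarLefschetzBodyCounterexample.lean`).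
[cite: EtnyreFuller2006, §2] [cite: GompfStipsiczGSM1999, §8.2]
[file Topology/FourManifolds/LefschetzHandlebodyEuler] -/
def finrank_singularHomology_one_eq_bettiNumber_of_isPageSystem : Prop :=
  ∀ (P : Type) [TopologicalSpace P] [T2Space P] [SecondCountableTopology P] [CompactSpace P]
    [ConnectedSpace P] [ChartedSpace (EuclideanHalfSpace 2) P] [IsManifold (𝓡∂ 2) ∞ P]
    (_ : ConnectedSpace ↥((𝓡∂ 2).boundary P))
    (M : Type) [TopologicalSpace M] [T2Space M] [SecondCountableTopology M] [CompactSpace M]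
    [ChartedSpace (EuclideanSpace ℝ (Fin 3)) M] [IsManifold (𝓡 3) ∞ M]
    (ob : Literature.Geometry.Symplectic.OpenBook M) (J : P × ℝ → M) (_ : IsPageSystem ob J),
    Module.finrank ℚ (singularHomology ℚ ℚ M 1) = bettiNumber ℤ P 1

/-! ### A simultaneous attachment of 2-handles to a path-connected 4-manifold is path connected -/

/-- **`B ∪ H² ∪ ⋯ ∪ H²` is path connected when `B` is** (Kosinski 1993, VI §6; Gompf–Stipsicz
1999, §4.2: attaching handles of positive index to a connected manifold keeps it connected).  For a
simultaneous Kosinski attachment `W` of four-dimensional `2`-handles to a path-connected Hausdorff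
base `B` (`HandleAttachingMap.IsMultiAttachment h (𝓡∂ 4) W`): `W` is covered by the image of
`B ∖ ⋃ h̄ᵢ(S)` — path connected, the attaching circles being removed inside disjoint tubes with
path-connected punctured tubes (`HandleAttachingMap.isPathConnected_compl_iUnion_core₄`) — and the
images of the handle pieces `D⁴ ∖ S`, each path connected (star-shaped,
`contractibleSpace_beltPiece₄`) and meeting the former along the nonempty region `T ∖ S`
(`HandleAttachingMap.IsMultiAttachment.range_jA_inter_range_jB`).
[cite: Kosinski1993, VI §6] [cite: GompfStipsiczGSM1999, §8.2] -/
theorem HandleAttachingMap.IsMultiAttachment.pathConnectedSpace₄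
    {B : Type u} [TopologicalSpace B] [T2Space B] [ChartedSpace (EuclideanHalfSpace 4) B]
    [PathConnectedSpace B] {ι : Type} [Finite ι] {h : ι → HandleAttachingMap 3 2 B}
    {W : Type v} [TopologicalSpace W] [ChartedSpace (EuclideanHalfSpace 4) W]
    (hW : HandleAttachingMap.IsMultiAttachment h (𝓡∂ 4) W) : PathConnectedSpace W := by
  obtain ⟨hdisj, jA, jB, hjA, -, hjB, hcov, hglue, -⟩ := hW
  rw [pathConnectedSpace_iff_univ, ← hcov]
  refine isPathConnected_union_iUnion_of_meet ?_ (fun i => ?_) fun i => ?_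
  · -- the base minus the attaching circles is path connected
    rw [← image_univ]
    refine IsPathConnected.image ?_ hjA.isEmbedding.continuous
    have hApc : IsPathConnected (⋃ j, (h j).core)ᶜ :=
      HandleAttachingMap.isPathConnected_compl_iUnion_core₄ hdisj
    have := hApc.preimage_coe (subset_refl _)
    rwa [Subtype.coe_preimage_self] at this
  · -- each handle piece `D⁴ ∖ S` is path connected (star-shaped about the centre)
    rw [← image_univ]
    haveI := contractibleSpace_beltPiece₄
    exact isPathConnected_univ.image (hjB i).1.isEmbedding.continuous
  · -- … and meets the base in `jBᵢ(T ∖ S) ≠ ∅`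
    rw [HandleAttachingMap.IsMultiAttachment.range_jA_inter_range_jB hdisj hglue i]
    exact (isPathConnected_beltPiece₄_lamSq_ne_zero.image (hjB i).1.isEmbedding.continuous).nonempty

/-! ### (E) The Euler count, assembled -/

/-- **Euler characteristic of a Lefschetz handlebody, from the Betti number of its boundary open
book** (Gompf–Stipsicz 1999, §8.2; Kas 1980): granting the named fact (E-d)
`finrank_singularHomology_one_eq_bettiNumber_of_isPageSystem` (`b₁(∂B; ℚ) = b₁(P)` for an identity
open book with connected page boundary), the dictionary fact E
`length_eq_bettiNumber_of_isLefschetzHandlebodyOver` holds: if a Lefschetz handlebody `W = X(P; w)`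
over a page `P` with connected boundary is ℚ-acyclic in positive degrees, then `|w| = b₁(P)`.
Proof over `ℚ`: `W = B ∪ |w| two-handles` with `B` a compact connected orientable 1-handlebody
whose boundary open book has page system by `P`; `1 = b₀(W; ℚ) = χ_ℚ(W)` (`W` path connected,
`HandleAttachingMap.IsMultiAttachment.pathConnectedSpace₄`, and acyclic above degree `0`)
`= χ_ℚ(B) + |w|` (E-a, `HandleAttachingMap.IsMultiAttachment.finRelHomology_relEuler`)
`= (1 - b₁(B; ℚ)) + |w|` (E-b: `H_{≥2}(B; ℚ) = 0` by
`IsMorseAdapted.isZero_singularHomology_of_forall_morseIndex_ne`, finiteness by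
`IsMorseAdapted.finRelHomology_empty`), and `b₁(B; ℚ) = b₁(∂B; ℚ)` (E-c,
`finrank_singularHomology_one_boundaryData_eq`, `B` oriented) `= b₁(P)` (E-d).
[cite: GompfStipsiczGSM1999, §8.2] [cite: Kas1980] -/
theorem length_eq_bettiNumber_of_isLefschetzHandlebodyOver_of_isPageSystemBetti
    (hEd : finrank_singularHomology_one_eq_bettiNumber_of_isPageSystem) :
    length_eq_bettiNumber_of_isLefschetzHandlebodyOver := by
  intro P _ _ _ _ _ _ _ hP o w W _ _ hW hac
  obtain ⟨B, _, _, _, _, _, _, _, b, ob, J, δ, h, hB, ⟨oB⟩, hl, hWatt⟩ := hW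
  -- the abstract boundary `∂B` is a closed nonempty `3`-manifold
  haveI : T2Space b.carrier := b.isSmoothEmbedding.isEmbedding.t2Space
  haveI : SecondCountableTopology b.carrier :=
    b.isSmoothEmbedding.isEmbedding.secondCountableTopology
  haveI : CompactSpace b.carrier := b.compactSpace_carrier
  haveI : Nonempty b.carrier := ⟨ob.tube ⟨0, ob.k_pos⟩ (circlePt 0, 0)⟩
  -- (E-d): `b₁(∂B; ℚ) = b₁(P)`
  have hEd' : Module.finrank ℚ (singularHomology ℚ ℚ b.carrier 1) = bettiNumber ℤ P 1 :=
    hEd P hP b.carrier ob J hl.pageSystem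
  -- (E-b): the Morse function of the `1`-handlebody `B`: `H_j(B; ℚ) = 0` for `j ≥ 2`, and
  -- `H_•(B; ℚ)` is finitely generated
  obtain ⟨f, hf, hidx⟩ := hB
  have hne : ∀ j, 2 ≤ j → ∀ z ∈ criticalSet (𝓡∂ (3 + 1)) f, morseIndex (𝓡∂ (3 + 1)) f z ≠ j :=
    fun j hj z hz e => by
      have := hidx z (mem_criticalSet.1 hz)
      omega
  have hZ : ∀ j, 2 ≤ j → IsZero (singularHomology ℚ ℚ B j) := fun j hj =>
    hf.isZero_singularHomology_of_forall_morseIndex_ne ℚ ℚ (hne j hj)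
  obtain ⟨hFinB, -⟩ := hf.finRelHomology_empty ℚ ℚ
  -- (E-c): `b₁(∂B; ℚ) = b₁(B; ℚ)`
  have hEc : Module.finrank ℚ (singularHomology ℚ ℚ b.carrier 1) =
      Module.finrank ℚ (singularHomology ℚ ℚ B 1) :=
    finrank_singularHomology_one_boundaryData_eq oB b (hZ 2 le_rfl) (hZ 3 (by norm_num))
  -- (E-a): `χ_ℚ(W) = χ_ℚ(B) + |w|`
  obtain ⟨-, hχ⟩ := hWatt.finRelHomology_relEuler ℚ ℚ hFinB
  -- `B` and `W` are path connected
  haveI : LocallyPathConnectedSpace B :=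
    ChartedSpace.locallyPathConnectedSpace (EuclideanHalfSpace 4) B
  haveI : PathConnectedSpace B := pathConnectedSpace_iff_connectedSpace.2 ‹_›
  haveI : PathConnectedSpace W := hWatt.pathConnectedSpace₄
  -- `χ_ℚ(B) = b₀(B; ℚ) - b₁(B; ℚ) = 1 - b₁(B; ℚ)`
  have hχB : relEuler ℚ ℚ B ∅ = 1 - (Module.finrank ℚ (singularHomology ℚ ℚ B 1) : ℤ) := by
    have h2 : FinRelHomology ℚ ℚ B ∅ 2 :=
      FinRelHomology.empty_of_absolute hFinB.finite_singularHomology fun k hk => hZ k hk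
    rw [h2.relEuler_empty_eq_sum, Finset.sum_range_succ, Finset.sum_range_one,
      finrank_singularHomology_zero_of_pathConnectedSpace ℚ ℚ, Module.finrank_self]
    push_cast
    ring
  -- `χ_ℚ(W) = b₀(W; ℚ) = 1`
  have hχW : relEuler ℚ ℚ W ∅ = 1 := by
    have h1 : FinRelHomology ℚ ℚ W ∅ 1 := by
      refine FinRelHomology.empty_of_absolute (fun k => ?_) fun k hk => hac k hk
      cases k with
      | zero => exact finite_singularHomology_zero_of_module_finite ℚ ℚ
      | succ k => exact finite_of_isZero (hac _ k.succ_pos)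
    rw [h1.relEuler_empty_eq_sum, Finset.sum_range_one,
      finrank_singularHomology_zero_of_pathConnectedSpace ℚ ℚ, Module.finrank_self]
    simp
  -- assemble: `1 = (1 - b₁(B; ℚ)) + |w|` in `ℤ`
  rw [hχW, hχB, Fintype.card_fin, Module.finrank_self] at hχ
  have hlen : (w.length : ℤ) = Module.finrank ℚ (singularHomology ℚ ℚ B 1) := by
    push_cast at hχ
    linarith
  rw [← hEd', hEc]
  exact_mod_cast hlen

end Literature.Topology.FourManifolds

end
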